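import Summits.CriticalPhenomena.CardyFormulaZ2.Theorems.CardyFlipRussoQuadrupoleSelectionRulePoissonPerturbationPart1
import Literature.Analysis.FunctionSpaces.PoissonSuperpositionProofs
import Mathlib.MeasureTheory.Measure.Lebesgue.Complex
import Mathlib.Analysis.Calculus.Deriv.Basic

/-!
# The Poisson perturbation (Margulis–Russo) formula, one-sided superposition form

Helper file for the crux `QuadrupoleSelectionRule` (stmt-CriticalPhenomena-7029, informal) of
route `CardyFlipRusso` (sub-problem `CardyFormulaZ2`), line `Sketch`, stub W2
(`PoissonPerturbationFormula` of idea card `poisson-ward-insertion`): the annealed Russo formula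
for the Poisson superposition leg L2 of the Voronoi hub. Thin the jittered lattice and superpose
an independent Poisson process `c'_t` of intensity `t • ρ` on the rest `c` (law `P`); the
annealed observable is `t ↦ 𝔼 F(c ∪ c'_t) = ∫ F(c ∪ c') d(P ⊗ Q_t)`, and its right derivative
at `t = 0` is the expected *insertion effect* `∫ (𝔼_P F(c ∪ {x}) - 𝔼_P F(c)) ρ(dx)` — the
derivative of a Poisson expectation in the intensity is the expected add-one-point difference
(G. Last, M. Penrose, *Lectures on the Poisson Process* (2017), Thm 19.1, the perturbation /
Margulis–Russo formula for Poisson functionals; here in the elementary one-sided form at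
intensity `0`, for bounded measurable `F`).

Proof: by Fubini the observable is `𝔼_{Q_t} Φ` with `Φ(c') = ∫ F(c ∪ c') dP` bounded and
measurable (superposition is measurable, `PointConfig.measurable_union'`); the second-order
expansion `|𝔼_{Q_t} Φ - e^{-tm} Φ(∅) - t e^{-tm} ∫ Φ({a}) ρ(da)| ≤ K (tm)²` (`m = ρ(E)`) of the
sibling file `…PoissonPerturbationPart1` (`abs_integral_sub_le_of_isPoissonPointProcess`: void
probability, the one-point slice of the Poisson law from the Mecke equation, and
`Q_t(N ≥ 2) ≤ (tm)²`) together with `|e^{-x} - 1| ≤ x`, `|e^{-x} - 1 + x| ≤ x²` gives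
`|f(t) - f(0) - t D| ≤ L t²` for `t ≥ 0`, whence the right derivative.

Contents: the general statement `hasDerivWithinAt_integral_union_poisson` (any second countable
Hausdorff Borel space, any finite law `P` of the rest) and its specialisation
`poisson_perturbation_hasDerivWithinAt` to the plane with `P` a Poisson process of Lebesgue
intensity (the registered stub signature; of `P` only its being a probability law is used). The
two-sided formula at `t > 0` follows by superposing `Q_t` first
(`IsPoissonPointProcess.superposition_holds`) and is deliberately not stated here.
-/

noncomputable section

open MeasureTheory ProbabilityTheory Filter Set
open scoped ENNReal NNReal Topology

namespace Summit.CriticalPhenomena.CardyFormulaZ2.Theorems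

open Literature.Analysis.FunctionSpaces

section Poisson

variable {E : Type*} [TopologicalSpace E] [T2Space E] [SecondCountableTopology E]
  [MeasurableSpace E] [BorelSpace E]

/-- **The Poisson perturbation (Margulis–Russo) formula, one-sided superposition form, on a
second countable Hausdorff Borel space.** Let `P` be any finite law of a "rest" configuration
`c`, `ρ` a finite atomless measure, and `Q t` (for `t ≥ 0`) a Poisson point process of intensity
`t • ρ`. For bounded measurable `F`, the annealed observable `t ↦ ∫ F(c ∪ c') d(P ⊗ Q_t)` has
right derivative `∫ (∫ F(c ∪ {x}) dP - ∫ F dP) ρ(dx)` at `t = 0`: the expected insertion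
effect (Last–Penrose 2017, Thm 19.1, at intensity `0`; Russo 1981 / Margulis 1974 for the
discrete analogue). [cite: LastPenrose2017, Thm 19.1] -/
theorem hasDerivWithinAt_integral_union_poisson
    (P : Measure (PointConfig E)) [IsFiniteMeasure P]
    (ρ : Measure E) [IsFiniteMeasure ρ] (hρ : ∀ x, ρ {x} = 0)
    (Q : ℝ → Measure (PointConfig E))
    (hQ : ∀ t, 0 ≤ t → IsPoissonPointProcess ((ENNReal.ofReal t) • ρ) (Q t))
    (F : PointConfig E → ℝ) (hFm : Measurable F) (M : ℝ) (hFb : ∀ c, |F c| ≤ M) :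
    HasDerivWithinAt (fun t : ℝ => ∫ p, F (p.1 ∪ p.2) ∂(P.prod (Q t)))
      (∫ x, ((∫ c, F (c ∪ PointConfig.ofFn ![x]) ∂P) - ∫ c, F c ∂P) ∂ρ)
      (Set.Ici 0) 0 := by
  classical
  have hU : Measurable fun p : PointConfig E × PointConfig E => p.1 ∪ p.2 :=
    PointConfig.measurable_union'
  have hFU : StronglyMeasurable fun p : PointConfig E × PointConfig E => F (p.1 ∪ p.2) :=
    (hFm.comp hU).stronglyMeasurable
  set Φ : PointConfig E → ℝ := fun c' => ∫ c, F (c ∪ c') ∂P with hΦdef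
  have hΦm : StronglyMeasurable Φ := hFU.integral_prod_left'
  have hM : 0 ≤ M := (abs_nonneg _).trans (hFb ∅)
  set K := M * P.real univ with hKdef
  have hΦb : ∀ c', |Φ c'| ≤ K := fun c' => by
    have h := norm_integral_le_of_norm_le_const (μ := P) (f := fun c => F (c ∪ c')) (C := M)
      (Eventually.of_forall fun c => by rw [Real.norm_eq_abs]; exact hFb _)
    rwa [Real.norm_eq_abs] at h
  have hK : 0 ≤ K := (abs_nonneg _).trans (hΦb ∅)
  set m := ρ.real univ with hmdef
  have hm : 0 ≤ m := measureReal_nonneg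
  have hg : Measurable fun a : E => PointConfig.ofFn (fun _ : Fin 1 => a) := measurable_ofFn_one
  set I := ∫ a, Φ (PointConfig.ofFn (fun _ : Fin 1 => a)) ∂ρ with hIdef
  -- Fubini: the observable is `𝔼_{Q t} Φ`
  have hf : ∀ t, 0 ≤ t → ∫ p, F (p.1 ∪ p.2) ∂(P.prod (Q t)) = ∫ c', Φ c' ∂(Q t) := by
    intro t ht
    haveI := (hQ t ht).isProbabilityMeasure
    exact integral_prod_symm (fun p : PointConfig E × PointConfig E => F (p.1 ∪ p.2))
      (Integrable.of_bound hFU.aestronglyMeasurable M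
        (Eventually.of_forall fun p => by rw [Real.norm_eq_abs]; exact hFb _))
  -- the intensity `t • ρ`
  have hμ : ∀ t, 0 ≤ t → ((ENNReal.ofReal t) • ρ).real univ = t * m := fun t ht => by
    rw [measureReal_def, Measure.smul_apply, smul_eq_mul, ENNReal.toReal_mul,
      ENNReal.toReal_ofReal ht, hmdef, measureReal_def]
  have hμfin : ∀ t, ((ENNReal.ofReal t) • ρ) univ ≠ ∞ := fun t => by
    rw [Measure.smul_apply, smul_eq_mul]
    exact ENNReal.mul_ne_top ENNReal.ofReal_ne_top (measure_ne_top ρ _)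
  have hμat : ∀ t (x : E), ((ENNReal.ofReal t) • ρ) {x} = 0 := fun t x => by
    rw [Measure.smul_apply, smul_eq_mul, hρ x, mul_zero]
  have hIt : ∀ t, 0 ≤ t →
      ∫ a, Φ (PointConfig.ofFn (fun _ : Fin 1 => a)) ∂((ENNReal.ofReal t) • ρ) = t * I :=
    fun t ht => by rw [integral_smul_measure, ENNReal.toReal_ofReal ht, smul_eq_mul]
  -- the second-order expansion at every `t ≥ 0`
  have hkey : ∀ t, 0 ≤ t → |∫ c', Φ c' ∂(Q t) -
      (Real.exp (-(t * m)) * Φ ∅ + Real.exp (-(t * m)) * (t * I))| ≤ K * (t * m) ^ 2 := by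
    intro t ht
    have h := abs_integral_sub_le_of_isPoissonPointProcess (hQ t ht) (hμfin t) (hμat t) Φ hΦm
      K hΦb
    rwa [hμ t ht, hIt t ht] at h
  -- the value at `t = 0` and the derivative
  have hΦ0 : Φ ∅ = ∫ c, F c ∂P := by
    simp only [hΦdef, union_empty_pointConfig]
  have hf0 : ∫ p, F (p.1 ∪ p.2) ∂(P.prod (Q 0)) = Φ ∅ := by
    rw [hf 0 le_rfl]
    have h := hkey 0 le_rfl
    have h' : |∫ c', Φ c' ∂(Q 0) - Φ ∅| ≤ 0 := by simpa using h
    exact sub_eq_zero.1 (abs_nonpos_iff.1 h')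
  have hΦgi : Integrable (fun a : E => Φ (PointConfig.ofFn (fun _ : Fin 1 => a))) ρ :=
    Integrable.of_bound (hΦm.measurable.comp hg).aestronglyMeasurable K
      (Eventually.of_forall fun a => by rw [Real.norm_eq_abs]; exact hΦb _)
  have hD : ∫ x, ((∫ c, F (c ∪ PointConfig.ofFn ![x]) ∂P) - ∫ c, F c ∂P) ∂ρ = I - m * Φ ∅ := by
    simp_rw [ofFn_vec_one]
    rw [← hΦ0]
    change ∫ x, (Φ (PointConfig.ofFn (fun _ : Fin 1 => x)) - Φ ∅) ∂ρ = I - m * Φ ∅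
    rw [integral_sub hΦgi (integrable_const _), integral_const, smul_eq_mul]
  -- conclusion: `|f t - f 0 - t D| ≤ L t²` for `t ≥ 0`
  rw [hasDerivWithinAt_iff_isLittleO, Asymptotics.isLittleO_iff]
  intro ε hε
  set L := K * m ^ 2 + |Φ ∅| * m ^ 2 + |I| * m with hLdef
  have hev : ∀ᶠ t in 𝓝[Ici (0 : ℝ)] 0, t ∈ Ici (0 : ℝ) ∧ L * t ≤ ε := by
    refine eventually_mem_nhdsWithin.and ?_
    have h1 : Tendsto (fun t : ℝ => L * t) (𝓝 0) (𝓝 (L * 0)) :=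
      tendsto_const_nhds.mul tendsto_id
    rw [mul_zero] at h1
    exact (h1.eventually (eventually_le_nhds hε)).filter_mono nhdsWithin_le_nhds
  filter_upwards [hev] with t ht
  obtain ⟨ht0, hLt⟩ := ht
  rw [mem_Ici] at ht0
  rw [sub_zero, hf t ht0, hf0, hD, Real.norm_eq_abs, Real.norm_eq_abs, abs_of_nonneg ht0,
    smul_eq_mul]
  have h1 := hkey t ht0
  have he1 : |Real.exp (-(t * m)) - 1| ≤ t * m := by
    have h1 : Real.exp (-(t * m)) ≤ 1 :=
      Real.exp_le_one_iff.2 (neg_nonpos.2 (mul_nonneg ht0 hm))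
    have h2 : -(t * m) + 1 ≤ Real.exp (-(t * m)) := Real.add_one_le_exp _
    rw [abs_le]
    constructor <;> linarith
  have he2 : |Real.exp (-(t * m)) - 1 + t * m| ≤ (t * m) ^ 2 :=
    abs_exp_neg_sub_one_add_le (mul_nonneg ht0 hm)
  calc |∫ c', Φ c' ∂(Q t) - Φ ∅ - t * (I - m * Φ ∅)|
      = |(∫ c', Φ c' ∂(Q t) - (Real.exp (-(t * m)) * Φ ∅ + Real.exp (-(t * m)) * (t * I))) +
          Φ ∅ * (Real.exp (-(t * m)) - 1 + t * m) + t * I * (Real.exp (-(t * m)) - 1)| := by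
        congr 1
        ring
    _ ≤ |∫ c', Φ c' ∂(Q t) - (Real.exp (-(t * m)) * Φ ∅ + Real.exp (-(t * m)) * (t * I))| +
          |Φ ∅ * (Real.exp (-(t * m)) - 1 + t * m)| + |t * I * (Real.exp (-(t * m)) - 1)| :=
        abs_add_three _ _ _
    _ ≤ K * (t * m) ^ 2 + |Φ ∅| * (t * m) ^ 2 + t * |I| * (t * m) := by
        rw [abs_mul, abs_mul, abs_mul, abs_of_nonneg ht0]
        gcongr
    _ = L * t * t := by rw [hLdef]; ring
    _ ≤ ε * t := mul_le_mul_of_nonneg_right hLt ht0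

/-- **Stub W2 (`PoissonPerturbationFormula`, registered signature): the Poisson perturbation
(Margulis–Russo) formula for the Poisson superposition leg of the Voronoi hub.** In the plane,
let `P` be a Poisson point process of Lebesgue intensity (the rest of the configuration; only
its being a probability law is used), `ρ` a finite atomless measure and `Q t` (`t ≥ 0`) a
Poisson process of intensity `t • ρ`. For bounded measurable `F`, the annealed observable
`t ↦ ∫ F(c ∪ c') d(P ⊗ Q_t)` has right derivative at `t = 0` equal to the expected insertion
effect `∫ (∫ F(c ∪ {x}) P(dc) - ∫ F dP) ρ(dx)` (Last–Penrose 2017, Thm 19.1, one-sided form at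
intensity `0`). [cite: LastPenrose2017, Thm 19.1] -/
theorem poisson_perturbation_hasDerivWithinAt
    (P : Measure (PointConfig ℂ)) (hP : IsPoissonPointProcess (volume : Measure ℂ) P)
    (ρ : Measure ℂ) [IsFiniteMeasure ρ] (hρ : ∀ x, ρ {x} = 0)
    (Q : ℝ → Measure (PointConfig ℂ))
    (hQ : ∀ t, 0 ≤ t → IsPoissonPointProcess ((ENNReal.ofReal t) • ρ) (Q t))
    (F : PointConfig ℂ → ℝ) (hFm : Measurable F) (M : ℝ) (hFb : ∀ c, |F c| ≤ M) :
    HasDerivWithinAt (fun t : ℝ => ∫ p, F (p.1 ∪ p.2) ∂(P.prod (Q t)))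
      (∫ x, ((∫ c, F (c ∪ PointConfig.ofFn ![x]) ∂P) - ∫ c, F c ∂P) ∂ρ)
      (Set.Ici 0) 0 := by
  haveI := hP.isProbabilityMeasure
  exact hasDerivWithinAt_integral_union_poisson P ρ hρ Q hQ F hFm M hFb

end Poisson

end Summit.CriticalPhenomena.CardyFormulaZ2.Theorems

end
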